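import Literature.MathematicalPhysics.QuantumLattice.HubbardHubbardModelEtaODLROProofs
import Literature.MathematicalPhysics.QuantumLattice.FinDimSpectrumSectorGibbsLimit
import Literature.MathematicalPhysics.QuantumLattice.DWaveSourceProofs
import Literature.MathematicalPhysics.QuantumLattice.SectorSpectrum
import Literature.MathematicalPhysics.QuantumLattice.HubbardModelParticleHoleProofs
import Literature.MathematicalPhysics.QuantumLattice.LiebFluxPhaseProofs
import Summits.HubbardSuperconductivity.HubbardSuperconductivity.Theorems.ThermalWedgeTwSeededEnsembleEquivalenceBarrierPauliBlocking
import Summits.HubbardSuperconductivity.HubbardSuperconductivity.Theorems.ThermalWedgeTwSeededEnsembleEquivalenceBarrierAtomicDiagonal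
import Summits.HubbardSuperconductivity.HubbardSuperconductivity.Theorems.ThermalWedgeTwSeededEnsembleEquivalenceBarrierSiteBookkeeping

/-!
# Crux `TwSeededEnsembleEquivalence` (stmt-HubbardSuperconductivity-1698), line `exposed-density-duality` —
# STRUCTURAL BARRIER 1/2: the sector lower bound of the η-pairing counterexample (registered stub `stub_barrierSectorLowerBound`)

The crux-SHAPED statement is tested on a member of its own structural class {finite-range repulsive lattice fermions +
separable attractive pair seed}: the ATOMIC-LIMIT Hubbard torus (`t = 0`) with the on-site s-wave seed,
`HsCan = hubbardTorus 2 L 0 U − (g/L²)(pairField sWave L)ᴴ(pairField sWave L) = U·D̂ − (2g/L²)ηᴴη` (`η = Σ_x c_{x↓}c_{x↑}`).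
Here, from the landed barrier stubs `stub_sWavePairFluctuationBound` (Pauli blocking `‖P_sψ‖² ≤ 2Σ|ψ(s)|²D(s)(E(s)+1)`),
`stub_atomicHubbard_eq_diagonal` (`hubbardTorus 2 L 0 U = diag(U·D(s))`) and `stub_siteBookkeeping` (`#s + E = L² + D`):
the SECTOR LOWER BOUND `min(0, UN/2 − (g/L²)N(L² − N/2 + 1)) ≤ Re⟨ψ, HsCan ψ⟩` for unit `N`-particle `ψ` (chord inequality
for the concave quadratic `p ↦ Up − (2g/L²)p(L² − N + p + 1)` on `[0, N/2]`), hence for `minEnergyOn` in every joint sector.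
Part 2/2 (`…BarrierGap`) adds the grand-canonical trial states, the gap theorem and the failure of the crux-shaped statement.
No definitions; everything is proved. Yang–Zhang, Mod. Phys. Lett. B4 (1990) 759 (η-pairing / seniority).
-/

set_option linter.dupNamespace false

namespace Summit.HubbardSuperconductivity.HubbardSuperconductivity.Theorems.TwSeededEnsembleEquivalence.ExposedDensity

open Matrix Finset Literature.MathematicalPhysics.QuantumLattice Literature.Probability.LatticeModels
open scoped ComplexOrder Matrix.Norms.L2Operator

noncomputable section

namespace StructuralBarrier

variable (L : ℕ)

/-- `D(s) + E(s) ≤ L²` (doubly occupied and empty sites are disjoint sets of sites). [folklore] -/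
theorem dbl_add_emp_le (s : Finset (Orb (FermionTorus 2 L))) :
    ((Finset.univ.filter fun x : FermionTorus 2 L => orb x 0 ∈ s).filter fun x => orb x 1 ∈ s).card +
      ((Finset.univ.filter fun x : FermionTorus 2 L => orb x 0 ∉ s).filter fun x => orb x 1 ∉ s).card ≤ L ^ 2 := by
  rw [← Finset.card_union_of_disjoint]
  · calc _ ≤ (Finset.univ : Finset (FermionTorus 2 L)).card := Finset.card_le_univ _
      _ = L ^ 2 := by rw [Finset.card_univ, card_fermionTorus]
  · rw [Finset.disjoint_left]
    intro x h1 h2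
    simp only [Finset.mem_filter, Finset.mem_univ, true_and] at h1 h2
    exact h2.1 h1.1

/-- The chord inequality for a concave quadratic through the origin: `f(p) = p(a − b p)`, `b ≥ 0`,
`0 ≤ p ≤ P` ⇒ `f(p) ≥ min(0, f(P))`. [folklore] -/
theorem quad_chord {a b p P : ℝ} (hb : 0 ≤ b) (hp : 0 ≤ p) (hpP : p ≤ P) :
    min 0 (P * (a - b * P)) ≤ p * (a - b * p) := by
  rcases eq_or_lt_of_le (hp.trans hpP) with hP | hP
  · have : p = 0 := le_antisymm (hP ▸ hpP) hp
    subst this; simp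
  · rcases le_or_gt 0 (a - b * P) with hf | hf
    · rw [min_eq_left (mul_nonneg hP.le hf)]
      have h1 : 0 ≤ a - b * p := by nlinarith [mul_nonneg hb (sub_nonneg.2 hpP)]
      exact mul_nonneg hp h1
    · rw [min_eq_right (mul_nonpos_iff.2 (Or.inl ⟨hP.le, hf.le⟩))]
      have h1 : a - b * (p + P) < 0 := by nlinarith [mul_nonneg hb hp]
      nlinarith [mul_nonneg (sub_nonneg.2 hpP) (neg_nonneg.2 h1.le)]


/-! ### Linear-algebra helpers -/

/-- `⟨ψ, PᴴP ψ⟩ = ⟨Pψ, Pψ⟩`. [folklore] -/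
theorem star_dotProduct_conjTranspose_mul_mulVec {ι : Type*} [Fintype ι] (P : Matrix ι ι ℂ) (ψ : ι → ℂ) :
    star ψ ⬝ᵥ ((Pᴴ * P) *ᵥ ψ) = star (P *ᵥ ψ) ⬝ᵥ (P *ᵥ ψ) := by
  rw [← mulVec_mulVec, dotProduct_mulVec, star_mulVec]

/-- `Re ⟨ψ, diag(d) ψ⟩ = Σ d(s) ‖ψ s‖²` for a real diagonal. [folklore] -/
theorem re_star_dotProduct_diagonal_mulVec {ι : Type*} [Fintype ι] [DecidableEq ι] (d : ι → ℝ) (ψ : ι → ℂ) :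
    (star ψ ⬝ᵥ (Matrix.diagonal (fun s => ((d s : ℝ) : ℂ)) *ᵥ ψ)).re = ∑ s, d s * ‖ψ s‖ ^ 2 := by
  simp only [mulVec_diagonal, dotProduct, Pi.star_apply, Complex.star_def, Complex.re_sum]
  refine Finset.sum_congr rfl fun s _ => ?_
  have : (starRingEnd ℂ) (ψ s) * (((d s : ℝ) : ℂ) * ψ s) = ((d s * ‖ψ s‖ ^ 2 : ℝ) : ℂ) := by
    rw [mul_left_comm, Complex.conj_mul', Complex.ofReal_mul, Complex.ofReal_pow]
  rw [this, Complex.ofReal_re]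


/-! ### The sector lower bound -/

/-- **Sector lower bound**: `Re⟨ψ, HsCan ψ⟩ ≥ min(0, UN/2 − (g/L²)N(L² − N/2 + 1))` for unit `N`-particle `ψ`
(`Re⟨ψ,HsCanψ⟩ = Σ_s U D(s)|ψ(s)|² − (g/L²)‖P_sψ‖² ≥ Σ_s |ψ(s)|² f(D(s))`, `f(p) = Up − (2g/L²)p(L² − N + p + 1) ≥ min(0,f(N/2))`
on `[0, N/2]`). [folklore] -/
theorem sector_lower
    (L : ℕ) [NeZero L] {U g : ℝ} (hg : 0 ≤ g) (N : ℕ)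
    (ψ : Fock (Orb (FermionTorus 2 L))) (hψN : IsNParticle N ψ) (hψ1 : star ψ ⬝ᵥ ψ = 1) :
    min 0 (U * N / 2 - g / (L : ℝ) ^ 2 * N * ((L : ℝ) ^ 2 - N / 2 + 1)) ≤
      (star ψ ⬝ᵥ ((hubbardTorus 2 L 0 U - ((g / (L : ℝ) ^ 2 : ℝ) : ℂ) •
        ((pairField sWave L)ᴴ * pairField sWave L)) *ᵥ ψ)).re := by
  have hc0 : 0 ≤ g / (L : ℝ) ^ 2 := by positivity
  -- Step 1: expand the Rayleigh quotient
  have hexp : (star ψ ⬝ᵥ ((hubbardTorus 2 L 0 U - ((g / (L : ℝ) ^ 2 : ℝ) : ℂ) •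
        ((pairField sWave L)ᴴ * pairField sWave L)) *ᵥ ψ)).re =
      (∑ s : Finset (Orb (FermionTorus 2 L)),
        (U * (((Finset.univ.filter fun x : FermionTorus 2 L => orb x 0 ∈ s).filter fun x => orb x 1 ∈ s).card : ℕ))
          * ‖ψ s‖ ^ 2) -
        g / (L : ℝ) ^ 2 * (star (pairField sWave L *ᵥ ψ) ⬝ᵥ (pairField sWave L *ᵥ ψ)).re := by
    rw [sub_mulVec, dotProduct_sub, Complex.sub_re, smul_mulVec, dotProduct_smul, smul_eq_mul,
      Complex.re_ofReal_mul, star_dotProduct_conjTranspose_mul_mulVec, stub_atomicHubbard_eq_diagonal L U,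
      re_star_dotProduct_diagonal_mulVec]
  rw [hexp]
  -- Step 2: the norm and the Pauli-blocking bound
  have hnorm : ∑ s, ‖ψ s‖ ^ 2 = 1 := by
    have h := congrArg Complex.re hψ1
    simp only [dotProduct, Pi.star_apply, Complex.star_def, Complex.re_sum, Complex.one_re] at h
    rw [← h]
    refine Finset.sum_congr rfl fun s _ => ?_
    rw [Complex.conj_mul', ← Complex.ofReal_pow, Complex.ofReal_re]
  have hPB := stub_sWavePairFluctuationBound L ψ
  -- Step 3: pointwise bound `|ψ s|² f(D s) ≥ |ψ s|² · m`
  set m : ℝ := min 0 (U * N / 2 - g / (L : ℝ) ^ 2 * N * ((L : ℝ) ^ 2 - N / 2 + 1)) with hm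
  have hpt : ∀ s : Finset (Orb (FermionTorus 2 L)),
      ‖ψ s‖ ^ 2 * m ≤
        U * (((Finset.univ.filter fun x : FermionTorus 2 L => orb x 0 ∈ s).filter fun x => orb x 1 ∈ s).card : ℕ) * ‖ψ s‖ ^ 2
        - g / (L : ℝ) ^ 2 * (2 * (‖ψ s‖ ^ 2 *
          ((((Finset.univ.filter fun x : FermionTorus 2 L => orb x 0 ∈ s).filter fun x => orb x 1 ∈ s).card : ℕ) : ℝ) *
          (((((Finset.univ.filter fun x : FermionTorus 2 L => orb x 0 ∉ s).filter fun x => orb x 1 ∉ s).card : ℕ) : ℝ) + 1))) := by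
    intro s
    by_cases hs : ψ s = 0
    · simp [hs]
    · -- an `N`-particle configuration
      have hcard : s.card = N := by
        by_contra h
        exact hs (hψN s h)
      have hbook := stub_siteBookkeeping L s
      have hDE := dbl_add_emp_le L s
      set Dn : ℕ := ((Finset.univ.filter fun x : FermionTorus 2 L => orb x 0 ∈ s).filter fun x => orb x 1 ∈ s).card
        with hDn
      set En : ℕ := ((Finset.univ.filter fun x : FermionTorus 2 L => orb x 0 ∉ s).filter fun x => orb x 1 ∉ s).card
        with hEn
      rw [hcard] at hbook
      -- real-number forms
      have hEr : (En : ℝ) = (L : ℝ) ^ 2 + Dn - N := by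
        have h : ((N + En : ℕ) : ℝ) = ((L ^ 2 + Dn : ℕ) : ℝ) := by exact_mod_cast hbook
        push_cast at h
        linarith
      have hD2 : (Dn : ℝ) ≤ (N : ℝ) / 2 := by
        have h1 : N + En = L ^ 2 + Dn := hbook
        have h2 : Dn + En ≤ L ^ 2 := hDE
        have h3 : 2 * Dn ≤ N := by omega
        have h4 : ((2 * Dn : ℕ) : ℝ) ≤ (N : ℝ) := by exact_mod_cast h3
        push_cast at h4
        linarith
      have hD0 : (0 : ℝ) ≤ Dn := by positivity
      have hq := quad_chord (a := U - 2 * (g / (L : ℝ) ^ 2) * ((L : ℝ) ^ 2 - N + 1))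
        (b := 2 * (g / (L : ℝ) ^ 2)) (by positivity) hD0 hD2
      have hm' : m = min 0 ((N : ℝ) / 2 * (U - 2 * (g / (L : ℝ) ^ 2) * ((L : ℝ) ^ 2 - N + 1) -
          2 * (g / (L : ℝ) ^ 2) * ((N : ℝ) / 2))) := by
        rw [hm]; congr 1; ring
      rw [← hm'] at hq
      have hψ0 : 0 ≤ ‖ψ s‖ ^ 2 := by positivity
      have key : ‖ψ s‖ ^ 2 * m ≤ ‖ψ s‖ ^ 2 * ((Dn : ℝ) * (U - 2 * (g / (L : ℝ) ^ 2) * ((L : ℝ) ^ 2 - N + 1) -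
          2 * (g / (L : ℝ) ^ 2) * Dn)) := mul_le_mul_of_nonneg_left hq hψ0
      rw [hEr]
      nlinarith [key]
  -- Step 4: sum the pointwise bounds
  have hsum := Finset.sum_le_sum fun s (_ : s ∈ Finset.univ) => hpt s
  rw [← Finset.sum_mul, hnorm, one_mul, Finset.sum_sub_distrib, ← Finset.mul_sum, ← Finset.mul_sum] at hsum
  have h2 : g / (L : ℝ) ^ 2 * (star (pairField sWave L *ᵥ ψ) ⬝ᵥ (pairField sWave L *ᵥ ψ)).re ≤
      g / (L : ℝ) ^ 2 * (2 * ∑ s : Finset (Orb (FermionTorus 2 L)), ‖ψ s‖ ^ 2 *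
          ((((Finset.univ.filter fun x : FermionTorus 2 L => orb x 0 ∈ s).filter fun x => orb x 1 ∈ s).card : ℕ) : ℝ) *
          (((((Finset.univ.filter fun x : FermionTorus 2 L => orb x 0 ∉ s).filter fun x => orb x 1 ∉ s).card : ℕ) : ℝ) + 1)) :=
    mul_le_mul_of_nonneg_left hPB hc0
  linarith


/-- **The sector energy is bounded below** by the same constant, in every joint sector `(N, S^z = M)`
(`sInf` over the Rayleigh set; `sInf ∅ = 0 ≥ min(0, ·)` covers an empty sector). [folklore] -/
theorem minEnergyOn_lower
    (L : ℕ) [NeZero L] {U g : ℝ} (hg : 0 ≤ g) (N : ℕ) (M : ℝ) :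
    min 0 (U * N / 2 - g / (L : ℝ) ^ 2 * N * ((L : ℝ) ^ 2 - N / 2 + 1)) ≤
      (hubbardTorus 2 L 0 U - ((g / (L : ℝ) ^ 2 : ℝ) : ℂ) •
        ((pairField sWave L)ᴴ * pairField sWave L)).minEnergyOn (szSector (Λ := FermionTorus 2 L) N M) := by
  unfold Matrix.minEnergyOn
  set S := {E : ℝ | ∃ ψ ∈ szSector (Λ := FermionTorus 2 L) N M, star ψ ⬝ᵥ ψ = 1 ∧
    E = (star ψ ⬝ᵥ (hubbardTorus 2 L 0 U - ((g / (L : ℝ) ^ 2 : ℝ) : ℂ) •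
      ((pairField sWave L)ᴴ * pairField sWave L)) *ᵥ ψ).re} with hS
  by_cases hne : S.Nonempty
  · refine le_csInf hne ?_
    rintro E ⟨ψ, hψK, hψ1, rfl⟩
    exact sector_lower L hg N ψ ((mem_szSector_iff N M ψ).1 hψK).1 hψ1
  · rw [Set.not_nonempty_iff_eq_empty.1 hne, Real.sInf_empty]
    exact min_le_left _ _

end StructuralBarrier

/-- **Registered stub `stub_barrierSectorLowerBound`**: the sector lower bound of the seeded atomic model in every joint
sector `(N, S^z = M)`. [folklore] -/
theorem stub_barrierSectorLowerBound :
    ∀ (L : ℕ) [NeZero L] (U g : ℝ) (N : ℕ) (M : ℝ), 0 ≤ g →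
      min 0 (U * N / 2 - g / (L : ℝ) ^ 2 * N * ((L : ℝ) ^ 2 - N / 2 + 1)) ≤
        (hubbardTorus 2 L 0 U - ((g / (L : ℝ) ^ 2 : ℝ) : ℂ) •
          ((pairField sWave L)ᴴ * pairField sWave L)).minEnergyOn (szSector (Λ := FermionTorus 2 L) N M) :=
  fun L _ _ _ N M hg => StructuralBarrier.minEnergyOn_lower L hg N M


end

end Summit.HubbardSuperconductivity.HubbardSuperconductivity.Theorems.TwSeededEnsembleEquivalence.ExposedDensity
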